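import Summits.NavierStokesRegularity.NavierStokesRegularity.Theorems.TerminalTraceTypeITraceScarL3StripRepresentative
import Literature.Analysis.FluidPDE.NSLocalLerayFarFieldRegularSlabProofs
import Literature.Analysis.FluidPDE.EnergyUniqueness
import HarnessLib

/-!
# Depth vorticity rigidity, part 6 — CLASS-UNIFORM derivative bounds of depth representatives and the
# time-Lipschitz bound of the ball enstrophy — helper for item `TerminalTrace.TypeITraceScarL3`
# (stmt-NavierStokesRegularity-18385), stub `stub_centreEnstrophyAtDepth` (Q1) of line `annulus-dichotomy` v4

Seat nsreg-C26-p1 (prover), `--supports stmt-NavierStokesRegularity-18385`; planner of record nsreg-p2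
g28, ROUND-26 §1c (Q1) / R26-Q1-targets `K1` («NOTE `K` is existential in the statement but the proof
builds it from `(C, D₀, a, b)` only; K1 needs that class-uniform form»).

* `exists_uniform_strip_bound` — there is `K = K(L, P₀)` such that for EVERY pair `(U, P)` in
  Albritton–Barker's class on every `Q(a)`, with unit-cylinder pressure bounds `∫_{Q(z₀,1)}|P|^{3/2} ≤ P₀`
  (`z₀.1 ≤ 0`) and `‖U‖ ≤ L` a.e. on `]a − 1, b[ × ℝ³` (`b ≤ 0`), EVERY continuous representative `V` of
  `U` on `]a, b[ × ℝ³` obeys `‖Dⁿ_x V‖ ≤ K`, `n ≤ 4`, there (Serrin's quantitative interior regularity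
  `NSBoundedHigherRegularityBounds_holds.exists_uniform_bound` on the hanging unit cylinders; two
  continuous representatives agree on the open cylinder).
* `abs_enstrophy_sub_le` — for a spatially smooth distributional Navier–Stokes solution on a strip with
  `‖Dⁿ_x V‖ ≤ K` (`n ≤ 4`), the ball enstrophy `t ↦ ∫_{B(x₀,r)} |curl V(t)|²` is Lipschitz in time with
  constant `2 κK · κK(3 + 2K) · |B(x₀,r)|`, `κ = ‖curlCLM‖` (classical vorticity equation
  `vorticity_c12_of_isDistributionalNSSolutionOn`, mean value theorem).

WHAT THIS IS NOT: not the stub, not item 18385, no statement about Navier–Stokes regularity.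
[folklore; SereginSverak2009 §2 p. 8; EscauriazaSereginSverak2003 §3 (3.26)–(3.31)]
-/

noncomputable section

set_option linter.dupNamespace false

namespace Summit.NavierStokesRegularity.NavierStokesRegularity.Theorems.TypeITraceScarL3

open MeasureTheory Set Function Filter Topology TopologicalSpace Metric InnerProductSpace
open Literature.Analysis Literature.Analysis.FluidPDE
open scoped NNReal ENNReal RealInnerProductSpace Laplacian

/-! ### Class-uniform derivative bounds for continuous depth representatives -/

/-- **Class-uniform bounds.**  For every velocity bound `L` and unit-cylinder pressure bound `P₀`
there is `K` such that: whenever `(U, P)` is in Albritton–Barker's class on every `Q(a)`,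
`∫_{Q(z₀,1)} |P|^{3/2} ≤ P₀` for all apices `z₀.1 ≤ 0`, `‖U‖ ≤ L` a.e. on `]a − 1, b[ × ℝ³` with
`b ≤ 0`, and `V` is ANY representative of `U` on `]a, b[ × ℝ³` which is continuous there, then
`‖Dⁿ_x V(t, x)‖ ≤ K` for `n ≤ 4` at every point of `]a, b[ × ℝ³`.  (`K` is the constant of
`NSBoundedHigherRegularityBounds_holds.exists_uniform_bound` for the unit cylinders; the local smooth
representative on the hanging cylinder `Q((min(t + 1/4, b), x), 1)` agrees with `V` near `(t, x)`.)
[cite: SereginSverak2009, §2 p. 8] -/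
theorem exists_uniform_strip_bound (L : ℝ) (P₀ : ℝ≥0) :
    ∃ K : ℝ, ∀ (U : ℝ → EuclideanSpace ℝ (Fin 3) → EuclideanSpace ℝ (Fin 3))
      (P : ℝ → EuclideanSpace ℝ (Fin 3) → ℝ) (a b : ℝ), b ≤ 0 →
      (∀ a' : ℝ, 0 < a' →
        IsSuitableWeakSolutionInBall a' (0 : ℝ × EuclideanSpace ℝ (Fin 3)) U P) →
      (∀ z₀ : ℝ × EuclideanSpace ℝ (Fin 3), z₀.1 ≤ 0 →
        ∫⁻ q in parabolicCylinder 1 z₀, ‖P q.1 q.2‖ₑ ^ (3 / 2 : ℝ) ≤ P₀) →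
      (∀ᵐ z ∂(volume.restrict (Ioo (a - 1) b ×ˢ (univ : Set (EuclideanSpace ℝ (Fin 3))))),
        ‖U z.1 z.2‖ ≤ L) →
      ∀ V : ℝ → EuclideanSpace ℝ (Fin 3) → EuclideanSpace ℝ (Fin 3),
        uncurry V =ᵐ[volume.restrict (Ioo a b ×ˢ (univ : Set (EuclideanSpace ℝ (Fin 3))))] uncurry U →
        ContinuousOn (uncurry V) (Ioo a b ×ˢ (univ : Set (EuclideanSpace ℝ (Fin 3)))) →
        ∀ n ≤ 4, ∀ z ∈ Ioo a b ×ˢ (univ : Set (EuclideanSpace ℝ (Fin 3))),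
          ‖iteratedFDeriv ℝ n (V z.1) z.2‖ ≤ K := by
  obtain ⟨K, hK⟩ := NSBoundedHigherRegularityBounds_holds.exists_uniform_bound 1 L P₀
    (r := 3 / 4) ⟨by norm_num, by norm_num⟩ 4
  refine ⟨K, fun U P a b hb hsw hP hbd V hVU hVc n hn z hz => ?_⟩
  set Ω : Set (ℝ × EuclideanSpace ℝ (Fin 3)) := Ioo a b ×ˢ (univ : Set (EuclideanSpace ℝ (Fin 3)))
    with hΩdef
  have hΩo : IsOpen Ω := isOpen_Ioo.prod isOpen_univ
  -- the hanging unit cylinder at `z`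
  set τ : ℝ := min (z.1 + (1 / 2 : ℝ) ^ 2) b with hτ
  set z₀ : ℝ × EuclideanSpace ℝ (Fin 3) := (τ, z.2) with hz₀
  have hzt : z.1 < b := hz.1.2
  have hτb : τ ≤ b := min_le_right _ _
  have hτ0 : τ ≤ 0 := hτb.trans hb
  have hτa : a < τ := lt_min (by linarith [hz.1.1]) (hz.1.1.trans hzt)
  have hzin : z ∈ parabolicCylinder (3 / 2 * (1 / 2 : ℝ)) z₀ := by
    have h := mem_parabolicCylinder_top (x := z.2) (by norm_num : (0 : ℝ) < 1 / 2) hzt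
    exact h
  have hzin' : z ∈ parabolicCylinder (3 / 4 : ℝ) z₀ := by
    rw [show (3 / 4 : ℝ) = 3 / 2 * (1 / 2) by norm_num]; exact hzin
  have hCsub : parabolicCylinder 1 z₀ ⊆ Ioo (a - 1) b ×ˢ (univ : Set (EuclideanSpace ℝ (Fin 3))) := by
    rintro ⟨s, y⟩ hq
    rw [mem_parabolicCylinder] at hq
    obtain ⟨⟨hs1, hs2⟩, -⟩ := hq
    simp only [hz₀] at hs1 hs2
    exact ⟨⟨by linarith, lt_of_lt_of_le hs2 hτb⟩, mem_univ _⟩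
  -- the hypotheses of the quantitative interior regularity on that cylinder
  have hsol : IsDistributionalNSSolutionOn (parabolicCylinderOpens 1 z₀) 1 0 U P := by
    refine isDistributionalNSSolutionOn_of_forall_cylinder (fun a' ha' => (hsw a' ha').1.distributional)
      (isOpen_parabolicCylinder _ _) ?_
    intro q hq
    exact ⟨lt_of_lt_of_le (hCsub hq).1.2 hb, mem_univ _⟩
  have hbdC : ∀ᵐ w ∂(volume.restrict (parabolicCylinder 1 z₀)), ‖U w.1 w.2‖ ≤ L :=
    ae_restrict_of_ae_restrict_of_subset hCsub hbd
  obtain ⟨W, hUW, hWc, -, -, hWbd⟩ := hK U P z₀ hsol hbdC (hP z₀ hτ0)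
  -- `V = W` on the open set `Q(z₀, 1) ∩ Ω`
  set O : Set (ℝ × EuclideanSpace ℝ (Fin 3)) := parabolicCylinder 1 z₀ ∩ Ω with hOdef
  have hOo : IsOpen O := (isOpen_parabolicCylinder _ _).inter hΩo
  have hzO : z ∈ O :=
    ⟨parabolicCylinder_mono (by norm_num) (by norm_num : (3 / 4 : ℝ) ≤ 1) _ hzin', hz⟩
  have hae : uncurry V =ᵐ[volume.restrict O] uncurry W := by
    have h1 : uncurry V =ᵐ[volume.restrict O] uncurry U :=
      ae_restrict_of_ae_restrict_of_subset inter_subset_right hVU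
    have h2 : uncurry U =ᵐ[volume.restrict O] uncurry W :=
      ae_restrict_of_ae_restrict_of_subset inter_subset_left hUW
    exact h1.trans h2
  have heq : EqOn (uncurry V) (uncurry W) O :=
    Measure.eqOn_open_of_ae_eq hae hOo (hVc.mono inter_subset_right) (hWc.mono inter_subset_left)
  rw [iteratedFDeriv_slice_eq_of_eqOn hOo heq n hzO]
  exact hWbd n hn z hzin'

/-! ### The ball enstrophy is Lipschitz in time -/

/-- **Time-Lipschitz bound of the ball enstrophy.**  Let `(V, P)` be a distributional Navier–Stokes
solution (`ν = 1`) on the strip `]a, b[ × ℝ³` with `C^∞` slices, all spatial derivatives jointly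
continuous and `‖Dⁿ_x V‖ ≤ K` for `n ≤ 4`.  Then for `t, t' ∈ ]a, b[` and every ball `B(x₀, r)`:
`|∫_B |curl V(t)|² − ∫_B |curl V(t')|²| ≤ 2κK · κK(3 + 2K) · |B| · |t − t'|`, `κ = ‖curlCLM‖`.
The vorticity solves `∂ₜω = Δω − (V·∇)ω + (ω·∇)V` classically
(`vorticity_c12_of_isDistributionalNSSolutionOn`), so `|∂ₜω| ≤ κK(3 + 2K)`; mean value theorem in
`t`, then `||ω|² − |ω'|²| ≤ (|ω| + |ω'|)|ω − ω'|`. [folklore; MajdaBertozziCUP2002 §2.4 (2.110)] -/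
theorem abs_enstrophy_sub_le
    {a b : ℝ} {V : ℝ → EuclideanSpace ℝ (Fin 3) → EuclideanSpace ℝ (Fin 3)}
    {P : ℝ → EuclideanSpace ℝ (Fin 3) → ℝ}
    (hsol : IsDistributionalNSSolutionOn
      ⟨Ioo a b ×ˢ (univ : Set (EuclideanSpace ℝ (Fin 3))), isOpen_Ioo.prod isOpen_univ⟩ 1 0 V P)
    (hCD : ∀ z ∈ Ioo a b ×ˢ (univ : Set (EuclideanSpace ℝ (Fin 3))), ContDiffAt ℝ (⊤ : ℕ∞) (V z.1) z.2)
    (hjc : ∀ n : ℕ, ContinuousOn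
      (fun z : ℝ × EuclideanSpace ℝ (Fin 3) => iteratedFDeriv ℝ n (V z.1) z.2)
      (Ioo a b ×ˢ (univ : Set (EuclideanSpace ℝ (Fin 3)))))
    {K : ℝ} (hK : ∀ n ≤ 4, ∀ z ∈ Ioo a b ×ˢ (univ : Set (EuclideanSpace ℝ (Fin 3))),
      ‖iteratedFDeriv ℝ n (V z.1) z.2‖ ≤ K)
    (x₀ : EuclideanSpace ℝ (Fin 3)) (r : ℝ) {t t' : ℝ} (ht : t ∈ Ioo a b) (ht' : t' ∈ Ioo a b) :
    |(∫ x in ball x₀ r, ‖curl (V t) x‖ ^ 2) - ∫ x in ball x₀ r, ‖curl (V t') x‖ ^ 2| ≤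
      2 * (‖curlCLM‖ * K) * (‖curlCLM‖ * K * (3 + 2 * K)) * (volume (ball x₀ r)).toReal * |t - t'| := by
  set I : Set ℝ := Ioo a b with hIdef
  have hIo : IsOpen I := isOpen_Ioo
  set Ω : Set (ℝ × EuclideanSpace ℝ (Fin 3)) := I ×ˢ (univ : Set (EuclideanSpace ℝ (Fin 3)))
    with hΩdef
  set κ : ℝ := ‖curlCLM‖ with hκ
  have hκ0 : 0 ≤ κ := by rw [hκ]; exact norm_nonneg curlCLM
  have hK0 : 0 ≤ K := (norm_nonneg _).trans (hK 0 (by norm_num) (t, x₀) ⟨ht, mem_univ _⟩)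
  -- ### the classical vorticity equation
  have hU4 : ∀ s ∈ I, ContDiffOn ℝ 4 (V s) (univ : Set (EuclideanSpace ℝ (Fin 3))) :=
    fun s hs y _ => ((hCD (s, y) ⟨hs, mem_univ _⟩).of_le (by norm_cast)).contDiffWithinAt
  have hΦ : ∀ n ≤ 4, ContinuousOn
      (fun z : ℝ × EuclideanSpace ℝ (Fin 3) => iteratedFDeriv ℝ n (V z.1) z.2) Ω := fun n _ => hjc n
  obtain ⟨-, -, hderiv, -, -⟩ :=
    vorticity_c12_of_isDistributionalNSSolutionOn hIo isOpen_univ hsol hU4 hΦ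
  have hvort : ∀ s, vorticity V s = curlCLM ∘ fderiv ℝ (V s) := fun s => by funext y; rfl
  -- ### pointwise bounds on the strip
  have hsmooth : ∀ s ∈ I, ContDiff ℝ (⊤ : ℕ∞) (V s) := fun s hs =>
    contDiff_iff_contDiffAt.2 fun y => hCD (s, y) ⟨hs, mem_univ _⟩
  have hV0 : ∀ s ∈ I, ∀ y, ‖V s y‖ ≤ K := fun s hs y => by
    have h := hK 0 (by norm_num) (s, y) ⟨hs, mem_univ _⟩
    rwa [norm_iteratedFDeriv_zero] at h
  have hV1 : ∀ s ∈ I, ∀ y, ‖fderiv ℝ (V s) y‖ ≤ K := fun s hs y => by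
    have h := hK 1 (by norm_num) (s, y) ⟨hs, mem_univ _⟩
    rwa [norm_iteratedFDeriv_one] at h
  have hω0 : ∀ s ∈ I, ∀ y, ‖vorticity V s y‖ ≤ κ * K := fun s hs y => by
    rw [vorticity_apply]
    exact (norm_curl_le _ _).trans (mul_le_mul_of_nonneg_left (hV1 s hs y) hκ0)
  have hDf : ∀ s ∈ I, ∀ y, ContDiffAt ℝ (⊤ : ℕ∞) (fderiv ℝ (V s)) y := fun s hs y =>
    ((hsmooth s hs).fderiv_right (m := (⊤ : ℕ∞)) (by norm_cast)).contDiffAt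
  have hω1 : ∀ s ∈ I, ∀ y, ‖fderiv ℝ (vorticity V s) y‖ ≤ κ * K := fun s hs y => by
    rw [← norm_iteratedFDeriv_one, hvort s]
    refine (ContinuousLinearMap.norm_iteratedFDeriv_comp_left curlCLM (hDf s hs y) (by norm_cast)).trans ?_
    rw [norm_iteratedFDeriv_fderiv]
    exact mul_le_mul_of_nonneg_left (hK 2 (by norm_num) (s, y) ⟨hs, mem_univ _⟩) hκ0
  have hω2 : ∀ s ∈ I, ∀ y, ‖Δ (vorticity V s) y‖ ≤ 3 * (κ * K) := fun s hs y => by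
    refine (norm_laplacian_le _ _).trans ?_
    rw [finrank_euclideanSpace_fin, ← norm_iteratedFDeriv_one, norm_iteratedFDeriv_fderiv, hvort s]
    push_cast
    refine mul_le_mul_of_nonneg_left ?_ (by norm_num)
    refine (ContinuousLinearMap.norm_iteratedFDeriv_comp_left curlCLM (hDf s hs y) (by norm_cast)).trans ?_
    rw [norm_iteratedFDeriv_fderiv]
    exact mul_le_mul_of_nonneg_left (hK 3 (by norm_num) (s, y) ⟨hs, mem_univ _⟩) hκ0
  set Λ : ℝ := κ * K * (3 + 2 * K) with hΛ
  have hRHS : ∀ s ∈ I, ∀ y,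
      ‖(1 : ℝ) • Δ (vorticity V s) y - convect (V s) (vorticity V s) y +
        convect (vorticity V s) (V s) y‖ ≤ Λ := by
    intro s hs y
    have h1 : ‖(1 : ℝ) • Δ (vorticity V s) y‖ ≤ 3 * (κ * K) := by rw [one_smul]; exact hω2 s hs y
    have h2 : ‖convect (V s) (vorticity V s) y‖ ≤ κ * K * K := by
      rw [convect_apply]
      exact (ContinuousLinearMap.le_opNorm _ _).trans
        (mul_le_mul (hω1 s hs y) (hV0 s hs y) (norm_nonneg _) (by positivity))
    have h3 : ‖convect (vorticity V s) (V s) y‖ ≤ K * (κ * K) := by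
      rw [convect_apply]
      exact (ContinuousLinearMap.le_opNorm _ _).trans
        (mul_le_mul (hV1 s hs y) (hω0 s hs y) (norm_nonneg _) hK0)
    calc ‖(1 : ℝ) • Δ (vorticity V s) y - convect (V s) (vorticity V s) y +
          convect (vorticity V s) (V s) y‖
        ≤ ‖(1 : ℝ) • Δ (vorticity V s) y - convect (V s) (vorticity V s) y‖ +
          ‖convect (vorticity V s) (V s) y‖ := norm_add_le _ _
      _ ≤ (‖(1 : ℝ) • Δ (vorticity V s) y‖ + ‖convect (V s) (vorticity V s) y‖) +
          ‖convect (vorticity V s) (V s) y‖ := by gcongr; exact norm_sub_le _ _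
      _ ≤ 3 * (κ * K) + κ * K * K + K * (κ * K) := by gcongr
      _ = Λ := by rw [hΛ]; ring
  -- ### mean value theorem in time, pointwise in `x`
  have hmvt : ∀ y, ‖vorticity V t y - vorticity V t' y‖ ≤ Λ * |t - t'| := by
    intro y
    have h := Convex.norm_image_sub_le_of_norm_hasDerivWithin_le
      (f := fun s => vorticity V s y) (s := I)
      (fun s hs => (hderiv s hs y (mem_univ _)).hasDerivWithinAt)
      (fun s hs => hRHS s hs y) (convex_Ioo a b) ht' ht
    rw [← Real.norm_eq_abs]
    exact h
  -- pointwise difference of the squares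
  have hpt : ∀ y, |‖curl (V t) y‖ ^ 2 - ‖curl (V t') y‖ ^ 2| ≤ 2 * (κ * K) * Λ * |t - t'| := by
    intro y
    have e : ‖curl (V t) y‖ ^ 2 - ‖curl (V t') y‖ ^ 2 =
        (‖curl (V t) y‖ + ‖curl (V t') y‖) * (‖curl (V t) y‖ - ‖curl (V t') y‖) := by ring
    rw [e, abs_mul]
    have h1 : |‖curl (V t) y‖ + ‖curl (V t') y‖| ≤ 2 * (κ * K) := by
      rw [abs_of_nonneg (by positivity)]
      have := hω0 t ht y
      have := hω0 t' ht' y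
      rw [vorticity_apply] at *
      linarith
    have h2 : |‖curl (V t) y‖ - ‖curl (V t') y‖| ≤ Λ * |t - t'| := by
      refine (abs_norm_sub_norm_le _ _).trans ?_
      have h := hmvt y
      rwa [vorticity_apply, vorticity_apply] at h
    calc |‖curl (V t) y‖ + ‖curl (V t') y‖| * |‖curl (V t) y‖ - ‖curl (V t') y‖|
        ≤ 2 * (κ * K) * (Λ * |t - t'|) :=
          mul_le_mul h1 h2 (abs_nonneg _) (by positivity)
      _ = 2 * (κ * K) * Λ * |t - t'| := by ring
  -- ### integrate over the ball
  by_cases hr : volume (ball x₀ r) = ⊤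
  · exact absurd hr measure_ball_lt_top.ne
  have hvol : volume (ball x₀ r) < ⊤ := measure_ball_lt_top
  have hint : ∀ s ∈ I, IntegrableOn (fun y => ‖curl (V s) y‖ ^ 2) (ball x₀ r) volume := by
    intro s hs
    have hc : Continuous fun y => ‖curl (V s) y‖ ^ 2 := by
      have h1 : Continuous (curl (V s)) := by
        rw [curl_eq_curlCLM_comp]
        exact curlCLM.continuous.comp ((hsmooth s hs).continuous_fderiv (by norm_cast))
      exact (h1.norm).pow 2
    refine Measure.integrableOn_of_bounded (M := (κ * K) ^ 2) hvol.ne hc.aestronglyMeasurable ?_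
    refine ae_of_all _ fun y => ?_
    rw [Real.norm_eq_abs, abs_of_nonneg (by positivity)]
    have h := hω0 s hs y
    rw [vorticity_apply] at h
    exact pow_le_pow_left₀ (norm_nonneg _) h 2
  rw [← integral_sub (hint t ht) (hint t' ht')]
  have h := norm_setIntegral_le_of_norm_le_const hvol
    (f := fun y => ‖curl (V t) y‖ ^ 2 - ‖curl (V t') y‖ ^ 2)
    (fun y _ => by rw [Real.norm_eq_abs]; exact hpt y)
  rw [Real.norm_eq_abs] at h
  calc |∫ y in ball x₀ r, (‖curl (V t) y‖ ^ 2 - ‖curl (V t') y‖ ^ 2)|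
      ≤ 2 * (κ * K) * Λ * |t - t'| * (volume (ball x₀ r)).toReal := h
    _ = 2 * (‖curlCLM‖ * K) * (‖curlCLM‖ * K * (3 + 2 * K)) * (volume (ball x₀ r)).toReal *
        |t - t'| := by rw [hΛ, hκ]; ring

end Summit.NavierStokesRegularity.NavierStokesRegularity.Theorems.TypeITraceScarL3

end
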